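import Mathlib
import Literature.Computability.AlgebraicComplexity.StandardFamilies
import Literature.Computability.AlgebraicComplexity.MignonRessayreBound

/-!
# Route PrincipalMinorColouring, item `ExcessRankUnbounded` (stmt-ValiantsHypothesis-3783) —
part 1/4: extracting low-order principal minors from a principal-minor representation

A principal-minor representation of the shifted permanent is the polynomial identity
`per_n(x + J) = n! · det(I_R + diag(x_{κ(1)}, …, x_{κ(R)}) · K)` with `K ∈ ℂ^{R × R}` and a
colouring `κ : [R] → [n]²`. This file turns it into usable scalar identities:

* `eval_pmRepr`: evaluate both sides at a point `s : [n]² → ℂ`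
  (`∑_σ ∏ᵢ (s(σ i, i) + 1) = n! · det(1 + diag(s ∘ κ) K)`);
* `det_one_add_diagonal_localize`: if the weight `s ∘ κ` is supported on three indices
  `ι : Fin 3 → Fin R`, the `R × R` determinant collapses to a `3 × 3` one
  (Weinstein–Aronszajn, `Matrix.det_one_add_mul_comm`);
* `prod_localize`: the permanent side factors cell by cell;
* `extract_minors`: from the resulting identity in three free weights `t ∈ ℂ³` the principal
  minors of orders `1, 2, 3` are read off by evaluating at the eight points `{0,1}³`;
* `triple_minors`: the packaged statement for three indices whose colours have SINGLETON fibres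
  — then `n! · det K_T` is the number of permutations through the cells `κ(T)`.

No new definitions; everything is `[folklore]` linear algebra.
-/

set_option linter.dupNamespace false

namespace Summit.ValiantsHypothesis.ValiantsHypothesis.Theorems.PrincipalMinorColouring

open MvPolynomial Matrix Finset Literature.Computability.AlgebraicComplexity

variable {n R : ℕ}

/-- **Evaluation form of a principal-minor representation.** Evaluating the polynomial identity
`per_n(x + J) = n! · det(1 + diag(x ∘ κ) K)` at a point `s` gives
`∑_σ ∏ᵢ (s(σ i, i) + 1) = n! · det(1 + diag(s ∘ κ) K)`. [folklore] -/
theorem eval_pmRepr {K : Matrix (Fin R) (Fin R) ℂ} {κ : Fin R → Fin n × Fin n}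
    (hrepr : MvPolynomial.aeval (fun e => MvPolynomial.X e + 1) (perPoly (Fin n) ℂ) =
      MvPolynomial.C (n.factorial : ℂ) * (1 + Matrix.diagonal (fun i => MvPolynomial.X (κ i)) *
        K.map (fun a : ℂ => (MvPolynomial.C a : MvPolynomial (Fin n × Fin n) ℂ))).det)
    (s : Fin n × Fin n → ℂ) :
    (∑ σ : Equiv.Perm (Fin n), ∏ i, (s (σ i, i) + 1)) =
      (n.factorial : ℂ) * (1 + Matrix.diagonal (fun i => s (κ i)) * K).det := by
  have h := congrArg (MvPolynomial.eval s) hrepr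
  rw [MvPolynomial.aeval_eq_bind₁, show MvPolynomial.eval s (bind₁ (fun e => X e + 1)
      (perPoly (Fin n) ℂ)) = MvPolynomial.eval (fun e => s e + 1) (perPoly (Fin n) ℂ) by
        rw [show MvPolynomial.eval s (bind₁ (fun e => X e + 1) (perPoly (Fin n) ℂ)) =
          MvPolynomial.eval (fun e => MvPolynomial.eval s ((fun e => X e + 1) e))
            (perPoly (Fin n) ℂ) from eval₂Hom_bind₁ _ _ _ _]
        simp, eval_perPoly, map_mul, MvPolynomial.eval_C, RingHom.map_det, map_add, map_one,
      map_mul] at h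
  rw [Matrix.permanent] at h
  simp only [Matrix.of_apply] at h
  have h1 : (MvPolynomial.eval s).mapMatrix (Matrix.diagonal fun i => X (κ i)) =
      Matrix.diagonal fun i => s (κ i) := by
    rw [RingHom.mapMatrix_apply, Matrix.diagonal_map (map_zero _)]
    simp only [MvPolynomial.eval_X]
  have h2 : (MvPolynomial.eval s).mapMatrix
      (K.map fun a : ℂ => (MvPolynomial.C a : MvPolynomial (Fin n × Fin n) ℂ)) = K := by
    rw [RingHom.mapMatrix_apply, Matrix.map_map]
    ext i j
    simp
  rw [h, h1, h2]

/-- **Localisation of the determinant.** If the diagonal weight `d` is supported on the image of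
`ι : Fin 3 → Fin R` with values `t`, then `det(1 + diag(d) K) = det(1 + K|_ι · diag(t))`
(Weinstein–Aronszajn / Sylvester, `Matrix.det_one_add_mul_comm`). [folklore] -/
theorem det_one_add_diagonal_localize (K : Matrix (Fin R) (Fin R) ℂ) (ι : Fin 3 → Fin R)
    (t : Fin 3 → ℂ) (d : Fin R → ℂ) (hd : ∀ i, d i = ∑ m, if ι m = i then t m else 0) :
    (1 + Matrix.diagonal d * K).det = (1 + K.submatrix ι ι * Matrix.diagonal t).det := by
  let P : Matrix (Fin R) (Fin 3) ℂ := Matrix.of fun i m => if ι m = i then t m else 0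
  let Q : Matrix (Fin 3) (Fin R) ℂ := Matrix.of fun m i => if ι m = i then (1 : ℂ) else 0
  have hPQ : Matrix.diagonal d = P * Q := by
    ext i j
    rw [Matrix.mul_apply, Matrix.diagonal_apply]
    simp only [Matrix.of_apply, P, Q]
    by_cases hij : i = j
    · subst hij
      rw [if_pos rfl, hd]
      refine Finset.sum_congr rfl fun m _ => ?_
      by_cases hm : ι m = i <;> simp [hm]
    · rw [if_neg hij]
      symm
      refine Finset.sum_eq_zero fun m _ => ?_
      by_cases hm : ι m = i
      · simp [hm, hij]
      · simp [hm]
  have hQKP : Q * K * P = K.submatrix ι ι * Matrix.diagonal t := by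
    ext m m'
    rw [Matrix.mul_diagonal, Matrix.submatrix_apply]
    simp [Matrix.mul_apply, P, Q, Finset.sum_ite_eq]
  rw [hPQ, Matrix.mul_assoc, Matrix.det_one_add_mul_comm, hQKP]

/-- **Localisation of the permanent side.** With `s` the weight `t m` placed on the three
pairwise distinct cells `κ (ι m)`, each permutation term `∏ᵢ (s(σ i, i) + 1)` factors as
`∏ₘ (1 + t m · [σ passes through κ (ι m)])`. [folklore] -/
theorem prod_localize {κ : Fin R → Fin n × Fin n} (ι : Fin 3 → Fin R)
    (hdist : ∀ m m', κ (ι m) = κ (ι m') → m = m') (t : Fin 3 → ℂ) (σ : Equiv.Perm (Fin n)) :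
    (∏ i, ((∑ m, if κ (ι m) = (σ i, i) then t m else 0) + 1)) =
      ∏ m, (1 + t m * (if σ (κ (ι m)).2 = (κ (ι m)).1 then 1 else 0)) := by
  -- g m i : the contribution of cell m at column i
  set g : Fin 3 → Fin n → ℂ := fun m i => if κ (ι m) = (σ i, i) then t m else 0 with hg
  have hgg : ∀ i m m', m ≠ m' → g m i * g m' i = 0 := by
    intro i m m' hmm
    simp only [hg]
    split_ifs with h1 h2
    · exact absurd (hdist m m' (h1.trans h2.symm)) hmm
    · exact mul_zero _
    · exact zero_mul _
    · exact mul_zero _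
  have h1 : ∀ i, ((∑ m, g m i) + 1) = ∏ m, (1 + g m i) := by
    intro i
    rw [Fin.sum_univ_three, Fin.prod_univ_three]
    linear_combination (-(1 + g 2 i)) * hgg i 0 1 (by decide) - hgg i 0 2 (by decide)
      - hgg i 1 2 (by decide)
  have h2 : ∀ m, (∏ i, (1 + g m i)) =
      1 + t m * (if σ (κ (ι m)).2 = (κ (ι m)).1 then 1 else 0) := by
    intro m
    rw [Finset.prod_eq_single (κ (ι m)).2]
    · simp only [hg, mul_ite, mul_one, mul_zero]
      congr 1
      refine if_congr ⟨fun h => ?_, fun h => ?_⟩ rfl rfl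
      · exact ((congrArg Prod.fst h).symm : _)
      · exact Prod.ext h.symm rfl
    · intro i _ hi
      simp only [hg]
      rw [if_neg, add_zero]
      intro h
      exact hi (congrArg Prod.snd h).symm
    · intro h; exact absurd (Finset.mem_univ _) h
  simp_rw [show ∀ i, ((∑ m, if κ (ι m) = (σ i, i) then t m else 0) + 1) = ∏ m, (1 + g m i) from h1]
  rw [Finset.prod_comm]
  exact Finset.prod_congr rfl fun m _ => h2 m

/-- **Coefficient extraction in three variables.** From the identity
`∑_σ ∏ₘ (1 + tₘ χₘ(σ)) = N · det(1 + K' diag(t))` for all `t ∈ ℂ³` one reads off the principal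
minors of `K'` of orders `1, 2, 3` as the correlation sums of the `χₘ`. [folklore] -/
theorem extract_minors {ι : Type*} [Fintype ι] {N : ℂ} {K' : Matrix (Fin 3) (Fin 3) ℂ}
    {χ : Fin 3 → ι → ℂ}
    (h : ∀ t : Fin 3 → ℂ, (∑ σ, ∏ m, (1 + t m * χ m σ)) = N * (1 + K' * Matrix.diagonal t).det) :
    (N * K' 0 0 = ∑ σ, χ 0 σ) ∧ (N * K' 1 1 = ∑ σ, χ 1 σ) ∧ (N * K' 2 2 = ∑ σ, χ 2 σ) ∧
    (N * (K' 0 0 * K' 1 1 - K' 0 1 * K' 1 0) = ∑ σ, χ 0 σ * χ 1 σ) ∧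
    (N * (K' 0 0 * K' 2 2 - K' 0 2 * K' 2 0) = ∑ σ, χ 0 σ * χ 2 σ) ∧
    (N * (K' 1 1 * K' 2 2 - K' 1 2 * K' 2 1) = ∑ σ, χ 1 σ * χ 2 σ) ∧
    (N * K'.det = ∑ σ, χ 0 σ * χ 1 σ * χ 2 σ) := by
  have hL : ∀ t : Fin 3 → ℂ, (∑ σ, ∏ m, (1 + t m * χ m σ)) =
      (∑ σ : ι, (1 : ℂ)) + t 0 * (∑ σ, χ 0 σ) + t 1 * (∑ σ, χ 1 σ) + t 2 * (∑ σ, χ 2 σ)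
      + t 0 * t 1 * (∑ σ, χ 0 σ * χ 1 σ) + t 0 * t 2 * (∑ σ, χ 0 σ * χ 2 σ)
      + t 1 * t 2 * (∑ σ, χ 1 σ * χ 2 σ) + t 0 * t 1 * t 2 * (∑ σ, χ 0 σ * χ 1 σ * χ 2 σ) := by
    intro t
    rw [Finset.sum_congr rfl fun σ _ => show (∏ m, (1 + t m * χ m σ)) =
      1 + t 0 * χ 0 σ + t 1 * χ 1 σ + t 2 * χ 2 σ + t 0 * t 1 * (χ 0 σ * χ 1 σ)
      + t 0 * t 2 * (χ 0 σ * χ 2 σ) + t 1 * t 2 * (χ 1 σ * χ 2 σ)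
      + t 0 * t 1 * t 2 * (χ 0 σ * χ 1 σ * χ 2 σ) by rw [Fin.prod_univ_three]; ring]
    simp only [Finset.sum_add_distrib, ← Finset.mul_sum]
  have hR : ∀ t : Fin 3 → ℂ, (1 + K' * Matrix.diagonal t).det =
      1 + t 0 * K' 0 0 + t 1 * K' 1 1 + t 2 * K' 2 2
      + t 0 * t 1 * (K' 0 0 * K' 1 1 - K' 0 1 * K' 1 0)
      + t 0 * t 2 * (K' 0 0 * K' 2 2 - K' 0 2 * K' 2 0)
      + t 1 * t 2 * (K' 1 1 * K' 2 2 - K' 1 2 * K' 2 1) + t 0 * t 1 * t 2 * K'.det := by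
    intro t
    simp only [Matrix.det_fin_three, Matrix.add_apply, Matrix.mul_diagonal, Matrix.one_apply]
    simp
    ring
  have H : ∀ t : Fin 3 → ℂ, (∑ σ : ι, (1 : ℂ)) + t 0 * (∑ σ, χ 0 σ) + t 1 * (∑ σ, χ 1 σ)
      + t 2 * (∑ σ, χ 2 σ)
      + t 0 * t 1 * (∑ σ, χ 0 σ * χ 1 σ) + t 0 * t 2 * (∑ σ, χ 0 σ * χ 2 σ)
      + t 1 * t 2 * (∑ σ, χ 1 σ * χ 2 σ) + t 0 * t 1 * t 2 * (∑ σ, χ 0 σ * χ 1 σ * χ 2 σ) =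
      N * (1 + t 0 * K' 0 0 + t 1 * K' 1 1 + t 2 * K' 2 2
      + t 0 * t 1 * (K' 0 0 * K' 1 1 - K' 0 1 * K' 1 0)
      + t 0 * t 2 * (K' 0 0 * K' 2 2 - K' 0 2 * K' 2 0)
      + t 1 * t 2 * (K' 1 1 * K' 2 2 - K' 1 2 * K' 2 1) + t 0 * t 1 * t 2 * K'.det) := by
    intro t; rw [← hL, ← hR, h]
  have h000 := H ![0, 0, 0]
  have h100 := H ![1, 0, 0]
  have h010 := H ![0, 1, 0]
  have h001 := H ![0, 0, 1]
  have h110 := H ![1, 1, 0]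
  have h101 := H ![1, 0, 1]
  have h011 := H ![0, 1, 1]
  have h111 := H ![1, 1, 1]
  simp only [Matrix.cons_val_zero, Matrix.cons_val_one, Matrix.head_cons, Matrix.cons_val_two,
    Matrix.tail_cons, mul_zero, zero_mul, add_zero, mul_one, one_mul] at h000 h100 h010 h001
  simp only [Matrix.cons_val_zero, Matrix.cons_val_one, Matrix.head_cons, Matrix.cons_val_two,
    Matrix.tail_cons, mul_zero, zero_mul, add_zero, mul_one, one_mul] at h110 h101 h011 h111
  refine ⟨?_, ?_, ?_, ?_, ?_, ?_, ?_⟩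
  · linear_combination h000 - h100
  · linear_combination h000 - h010
  · linear_combination h000 - h001
  · linear_combination h100 + h010 - h110 - h000
  · linear_combination h100 + h001 - h101 - h000
  · linear_combination h010 + h001 - h011 - h000
  · linear_combination h000 - h100 - h010 - h001 + h110 + h101 + h011 - h111


/-- **Principal minors on fibre-one cells.** If `ι : Fin 3 → Fin R` picks three indices whose
colours `κ (ι m)` have singleton fibres, then the principal minors of `K` on `ι` of orders
`1, 2, 3`, multiplied by `n!`, count the permutations passing through the corresponding cells.
[folklore] -/
theorem triple_minors {K : Matrix (Fin R) (Fin R) ℂ} {κ : Fin R → Fin n × Fin n}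
    (hrepr : MvPolynomial.aeval (fun e => MvPolynomial.X e + 1) (perPoly (Fin n) ℂ) =
      MvPolynomial.C (n.factorial : ℂ) * (1 + Matrix.diagonal (fun i => MvPolynomial.X (κ i)) *
        K.map (fun a : ℂ => (MvPolynomial.C a : MvPolynomial (Fin n × Fin n) ℂ))).det)
    (ι : Fin 3 → Fin R) (hcls : ∀ m j, κ j = κ (ι m) → j = ι m) (hinj : Function.Injective ι) :
    ((n.factorial : ℂ) * K (ι 0) (ι 0) =
        ∑ σ : Equiv.Perm (Fin n), (if σ (κ (ι 0)).2 = (κ (ι 0)).1 then (1 : ℂ) else 0)) ∧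
    ((n.factorial : ℂ) * K (ι 1) (ι 1) =
        ∑ σ : Equiv.Perm (Fin n), (if σ (κ (ι 1)).2 = (κ (ι 1)).1 then (1 : ℂ) else 0)) ∧
    ((n.factorial : ℂ) * K (ι 2) (ι 2) =
        ∑ σ : Equiv.Perm (Fin n), (if σ (κ (ι 2)).2 = (κ (ι 2)).1 then (1 : ℂ) else 0)) ∧
    ((n.factorial : ℂ) * (K (ι 0) (ι 0) * K (ι 1) (ι 1) - K (ι 0) (ι 1) * K (ι 1) (ι 0)) =
        ∑ σ : Equiv.Perm (Fin n), (if σ (κ (ι 0)).2 = (κ (ι 0)).1 then (1 : ℂ) else 0) *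
          (if σ (κ (ι 1)).2 = (κ (ι 1)).1 then (1 : ℂ) else 0)) ∧
    ((n.factorial : ℂ) * (K (ι 0) (ι 0) * K (ι 2) (ι 2) - K (ι 0) (ι 2) * K (ι 2) (ι 0)) =
        ∑ σ : Equiv.Perm (Fin n), (if σ (κ (ι 0)).2 = (κ (ι 0)).1 then (1 : ℂ) else 0) *
          (if σ (κ (ι 2)).2 = (κ (ι 2)).1 then (1 : ℂ) else 0)) ∧
    ((n.factorial : ℂ) * (K (ι 1) (ι 1) * K (ι 2) (ι 2) - K (ι 1) (ι 2) * K (ι 2) (ι 1)) =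
        ∑ σ : Equiv.Perm (Fin n), (if σ (κ (ι 1)).2 = (κ (ι 1)).1 then (1 : ℂ) else 0) *
          (if σ (κ (ι 2)).2 = (κ (ι 2)).1 then (1 : ℂ) else 0)) ∧
    ((n.factorial : ℂ) * (K.submatrix ι ι).det =
        ∑ σ : Equiv.Perm (Fin n), (if σ (κ (ι 0)).2 = (κ (ι 0)).1 then (1 : ℂ) else 0) *
          (if σ (κ (ι 1)).2 = (κ (ι 1)).1 then (1 : ℂ) else 0) *
          (if σ (κ (ι 2)).2 = (κ (ι 2)).1 then (1 : ℂ) else 0)) := by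
  have hdist : ∀ m m', κ (ι m) = κ (ι m') → m = m' := fun m m' h => hinj (hcls m' (ι m) h)
  have key : ∀ t : Fin 3 → ℂ, (∑ σ : Equiv.Perm (Fin n),
      ∏ m, (1 + t m * (if σ (κ (ι m)).2 = (κ (ι m)).1 then (1 : ℂ) else 0))) =
      (n.factorial : ℂ) * (1 + K.submatrix ι ι * Matrix.diagonal t).det := by
    intro t
    have h := eval_pmRepr hrepr (fun e => ∑ m, if κ (ι m) = e then t m else 0)
    rw [det_one_add_diagonal_localize K ι t _ (fun i => ?_)] at h
    · rw [← h]
      exact Finset.sum_congr rfl fun σ _ => (prod_localize ι hdist t σ).symm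
    · refine Finset.sum_congr rfl fun m _ => ?_
      refine if_congr ⟨fun h' => (hcls m i h'.symm).symm, fun h' => h' ▸ rfl⟩ rfl rfl
  simpa only [Matrix.submatrix_apply] using extract_minors key

end Summit.ValiantsHypothesis.ValiantsHypothesis.Theorems.PrincipalMinorColouring
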